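import Summits.CriticalPhenomena.PercolationContinuityZ3.Theorems.PercNearOneGluingNoHeavyQuantSGCLightCellsAtoms3
import HarnessLib

/-!
# QUANT lane R8, T-DEC, leg (III), general second factor of `SingleGateConvClosed`: the light-pair residue when BOTH factors are
# AD3⁺-decomposed — three EXPLICIT finite-parameter cells (light pair ⊗ light pair, light pair ⊗ light triple, light triple ⊗ light
# triple) and the kernel reduction `CW + PP + PT + TT ⟹ SingleGateConvClosed` for every such pair of factors

builds on p205010 (kernel theorem, internal audit signed; external expert review pending)

Support file (`--supports stmt-CriticalPhenomena-4575`), QUANT lane, TYPER seat prim-quant-stmt (gen 31), rung R8 of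
`run/shared/lean/prim/quant/LADDER.md`; continues typer g30's `…QuantSGCLightCells` / `…HD` / `…Atoms3`.  Three `@[conjecture]` definitions
(sub-statements of `LawDec.SingleGateConvClosed` in which BOTH factors are explicit laws with at most three atoms), bookkeeping lemmas and
theorems; standard axioms, no sorries.

WHERE THIS SITS.  Typer g30 typed the light-pair residue of SGC's general second factor as two cells with a GENERAL admissible first factor
`μ₁` — `SGCLightPair` (L2: `μ₂` one admissible LIGHT two-point law) and `SGCLightTriple` (L3: `μ₂` one admissible non-heavy-decomposable
three-atom law) — and proved `WindowMixDEC ∧ L2 ∧ L3 ⟹` SGC's conclusion whenever ONE factor is AD3⁺-decomposed (a finite mixture of heavy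
pairs, admissible light pairs and admissible non-HD triples of its own mean).  L2 and L3 still quantify over an arbitrary admissible `μ₁`,
so they are as hard as SGC restricted to a small second factor.  THIS FILE removes the general factor on the other side as well: if the
FIRST factor is AD3⁺-decomposed too, the component-wise hook applied a second time (`decAt_gate_lconv_of_pieces_right` after `lconv_comm`)
leaves only pairs of COMPONENTS, and a pair of components with a heavy member is CW (arm-2 g35's `singleGateConvClosed_heavyMix_of_windowMix`,
the light/triple component being an admissible first factor).  What remains are three explicit cells whose every datum is a rational
function of at most 9 real and 8 natural parameters — statements of the kind the lane's exact census + certificate machinery settles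
regime by regime (as it did for `GatedSliceMixLaw'`):
* `LawDec.SGCLightPairPair` (PP): `μ₁ = {lo₁, hi₁; γ₁}`, `μ₂ = {lo₂, hi₂; γ₂}`, both LIGHT (`q·γᵢ < y`), both admissible (top-affordable,
  gated version DEC at every layer below the top) ⟹ `gate_q(μ₁ ∗ μ₂)` — the gated law on the (at most) five atoms
  `0, lo₁+lo₂, lo₁+hi₂, hi₁+lo₂, hi₁+hi₂` — is DEC at every layer `j′ < M₁ + M₂` (floor `y`).
* `LawDec.SGCLightPairTriple` (PT): `μ₁` an admissible light pair, `μ₂` an admissible non-HD triple (L3's datum).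
* `LawDec.SGCLightTripleTriple` (TT): both admissible non-HD triples.
REMARK (typer g30's "first sub-cell of L2", `μ₁` a gated blob `{0, a; g}`): a first factor whose only atom below its mean is `0` is
heavy-decomposable (its Lemma-P pairs are zero pairs, heavy by top-affordability), so that sub-cell is ALREADY CW by symmetry —
`singleGateConvClosed_zeroPair_left_of_windowMix` below records the blob instance; the first GENUINE light sub-cell is PP.
EXACT CENSUS of PP (typer g31, `explore/pp_census.py`, exact rational DEC LPs of lead g31's `explore/lib`, q ∈ {1, 9/10, 4/5, 3/4, 2/3, 1/2,
1/3}, floors on grids, `hiᵢ ≤ 10`): 7 462 instances (pairs of admissible light pairs) / 84 652 layer tests / 0 failures, minimal margin 0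
(tight instances exist).  ARM-2 g35's CANDIDATE MECHANISM for these cells (HEAVY-MIX-G35 §3): `μ₁ ∗ {lo, hi; γ} = shift_lo(slice μ₁ (hi−lo) γ)`
(`lconv_TP_eq_shift_slice`) — a LIGHT slice at its credit target followed by a gated shift whose target bonus is paid by the light pair's
top-affordability credit `lo ≥ (hi−lo)·x(x−γ)/(1−x)`.

THEOREMS.
* `LawDec.tp_laws`, `LawDec.triple_laws'`, `LawDec.mixture_laws` — law bookkeeping (nonnegativity, support, mass, mean).
* `LawDec.singleGateConvClosed_zeroPair_left_of_windowMix` — first factor a zero pair `{0, a; g}` (in SGC's binder it is forced heavy),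
  second factor admissible: SGC's conclusion from CW.
* **`LawDec.sgcLightPair_of_cells_left`** — `WindowMixDEC → SGCLightPairPair → SGCLightPairTriple →` the conclusion of cell L2 for
  `(μ₁, {lo, hi; γ})` whenever `μ₁` is AD3⁺-decomposed.
* (companion file `…QuantSGCLightCellsBothAssembly`): `LawDec.sgcLightTriple_of_cells_left` — `WindowMixDEC → PT → TT →` the conclusion of
  cell L3 for `(μ₁, triple)` whenever `μ₁` is AD3⁺-decomposed; `LawDec.singleGateConvClosed_of_bothLightCells` — `WindowMixDEC → PP → PT → TT →`
  SGC's conclusion for `(μ₁, μ₂)` whenever BOTH factors are AD3⁺-decomposed.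
So the chain of record reads: SGC ⟸[one factor AD3⁺] CW + L2 + L3 (typer g30) and L2, L3 ⟸[the other factor AD3⁺] CW + PP + PT + TT (this
file).  HONEST STATUS: NOT covered — pairs of factors one of which admits no AD3⁺ decomposition (arm-2 g35's top-affordability-TIGHT 4-atom
vertex `{1: 4/27, 2: 1/54, 4: 5/54, 6: 20/27}`, `q = 9/10`, `y = 3/4`; note that a TREE-BUILT law with at least one relay is never
top-affordability-tight at its own floor — every relay marginal exceeds the floor — but tightness is not what AD3 needs: by compactness the
same law stays non-AD3 at floors slightly below `3/4`).  `SingleGateConvClosed`, `WindowMixDEC`, L2, L3, PP, PT, TT, `GateMove`, `TreeDEC`,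
`FarTreeRow` are OPEN; nothing here is a published result; RATE class log\* / honest sentence unchanged.

[this work]; hooks: prim-quant-arm-2 g35 (`…QuantGateConvPieces`, `…QuantHeavyMixSingleGate`), cells L2/L3: prim-quant-stmt g30, SGC:
prim-quant-lead g28 (this lane).  The gluing rows served [cite: KozmaNitzan2024, Conjecture 3 (p. 15)]; product measure
[cite: Grimmett1999, §1.3 p. 10].
-/

noncomputable section

namespace Summit.CriticalPhenomena.PercolationContinuityZ3.Theorems

namespace Quant

open Finset

/-- two-point law notation `TP[lo, hi, g, h] = g·[h = hi] + (1 − g)·[h = lo]` (as in the lane's other files). -/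
local notation3 "TP[" lo ", " hi ", " g ", " h "]" =>
  (g : ℝ) * (if (h : ℕ) = (hi : ℕ) then (1 : ℝ) else 0) + (1 - (g : ℝ)) * (if (h : ℕ) = (lo : ℕ) then (1 : ℝ) else 0)

/-- three-atom law notation `TR[s₁, s₂, s₃, p₁, p₂, p₃, h] = p₁·[h = s₁] + p₂·[h = s₂] + p₃·[h = s₃]` (the literal shape used by
`LawDec.SGCLightTriple`). -/
local notation3 "TR[" s₁ ", " s₂ ", " s₃ ", " p₁ ", " p₂ ", " p₃ ", " h "]" =>
  (p₁ : ℝ) * (if (h : ℕ) = (s₁ : ℕ) then (1 : ℝ) else 0) + (p₂ : ℝ) * (if (h : ℕ) = (s₂ : ℕ) then (1 : ℝ) else 0)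
    + (p₃ : ℝ) * (if (h : ℕ) = (s₃ : ℕ) then (1 : ℝ) else 0)

namespace LawDec

/-! ### The three explicit light cells -/

/-- **CELL PP (LIGHT PAIR ⊗ LIGHT PAIR) of `SingleGateConvClosed`.**  Floor `0 < y < 1`, gate `0 < q ≤ 1`; first factor the two-point law
`{lo₁, hi₁; γ₁}` on `{0..M₁}` (`lo₁ < hi₁ ≤ M₁`, `0 ≤ γ₁ ≤ 1`), second factor `{lo₂, hi₂; γ₂}` on `{0..M₂}`, BOTH LIGHT (`q·γᵢ < y`), both
top-affordable (`y·Mᵢ ≤ q·(loᵢ + (hiᵢ − loᵢ)γᵢ)`, forcing `loᵢ ≥ 1`) and both with their gated version DEC at every layer `j′ < Mᵢ`;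
conclusion: `gate_q({lo₁, hi₁; γ₁} ∗ {lo₂, hi₂; γ₂})` is DEC at every layer `j′ < M₁ + M₂` (floor `y`).  A literal sub-statement of
`SingleGateConvClosed` (and of `SGCLightPair`); the first light⊗light cell.  EVIDENCE: exact census 7 462 instances / 84 652 layer tests / 0
failures (module docstring).
builds on p205010 (kernel theorem, internal audit signed; external expert review pending). [this work] [status: open] -/
@[conjecture] def SGCLightPairPair : Prop :=
  ∀ (y q γ₁ γ₂ : ℝ) (M₁ M₂ lo₁ hi₁ lo₂ hi₂ : ℕ),
    0 < y → y < 1 → 0 < q → q ≤ 1 →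
    lo₁ < hi₁ → hi₁ ≤ M₁ → 0 ≤ γ₁ → γ₁ ≤ 1 → q * γ₁ < y →
    y * (M₁ : ℝ) ≤ q * ((lo₁ : ℝ) + ((hi₁ : ℝ) - lo₁) * γ₁) →
    (∀ j', j' < M₁ → DECAt y j' M₁ (gate (fun h => TP[lo₁, hi₁, γ₁, h]) q)) →
    lo₂ < hi₂ → hi₂ ≤ M₂ → 0 ≤ γ₂ → γ₂ ≤ 1 → q * γ₂ < y →
    y * (M₂ : ℝ) ≤ q * ((lo₂ : ℝ) + ((hi₂ : ℝ) - lo₂) * γ₂) →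
    (∀ j', j' < M₂ → DECAt y j' M₂ (gate (fun h => TP[lo₂, hi₂, γ₂, h]) q)) →
    ∀ j', j' < M₁ + M₂ → DECAt y j' (M₁ + M₂)
      (gate (lconv M₁ M₂ (fun h => TP[lo₁, hi₁, γ₁, h]) (fun h => TP[lo₂, hi₂, γ₂, h])) q)

/-- **CELL PT (LIGHT PAIR ⊗ LIGHT TRIPLE) of `SingleGateConvClosed`.**  First factor an admissible LIGHT two-point law `{lo₁, hi₁; γ₁}` on
`{0..M₁}` (as in PP); second factor an admissible three-atom law `p₁δ_{s₁} + p₂δ_{s₂} + p₃δ_{s₃}` on `{0..M₂}` (`s₁ < s₂ < s₃ ≤ M₂`, all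
`pᵢ > 0`, `Σ pᵢ = 1`, mean `T₂`, `y·M₂ ≤ q·T₂`, gated version DEC at every layer `j′ < M₂`) which is NOT heavy-decomposable
(`s₂ ≤ T₂ ∧ q(T₂ − s₂) < y(s₃ − s₂)` or `T₂ < s₂ ∧ q(T₂ − s₁) < y(s₃ − s₁)`, cell L3's datum); conclusion: `gate_q(μ₁ ∗ μ₂)` DEC at every
layer `j′ < M₁ + M₂`.  A literal sub-statement of `SingleGateConvClosed` (and of `SGCLightTriple`, and — by `lconv_comm` — of `SGCLightPair`).
builds on p205010 (kernel theorem, internal audit signed; external expert review pending). [this work] [status: open] -/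
@[conjecture] def SGCLightPairTriple : Prop :=
  ∀ (y q γ₁ p₁ p₂ p₃ T₂ : ℝ) (M₁ M₂ lo₁ hi₁ s₁ s₂ s₃ : ℕ),
    0 < y → y < 1 → 0 < q → q ≤ 1 →
    lo₁ < hi₁ → hi₁ ≤ M₁ → 0 ≤ γ₁ → γ₁ ≤ 1 → q * γ₁ < y →
    y * (M₁ : ℝ) ≤ q * ((lo₁ : ℝ) + ((hi₁ : ℝ) - lo₁) * γ₁) →
    (∀ j', j' < M₁ → DECAt y j' M₁ (gate (fun h => TP[lo₁, hi₁, γ₁, h]) q)) →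
    s₁ < s₂ → s₂ < s₃ → s₃ ≤ M₂ → 0 < p₁ → 0 < p₂ → 0 < p₃ → p₁ + p₂ + p₃ = 1 →
    p₁ * (s₁ : ℝ) + p₂ * (s₂ : ℝ) + p₃ * (s₃ : ℝ) = T₂ →
    y * (M₂ : ℝ) ≤ q * T₂ →
    ((s₂ : ℝ) ≤ T₂ ∧ q * (T₂ - s₂) < y * ((s₃ : ℝ) - s₂) ∨ T₂ < (s₂ : ℝ) ∧ q * (T₂ - s₁) < y * ((s₃ : ℝ) - s₁)) →
    (∀ j', j' < M₂ → DECAt y j' M₂ (gate (fun h => TR[s₁, s₂, s₃, p₁, p₂, p₃, h]) q)) →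
    ∀ j', j' < M₁ + M₂ → DECAt y j' (M₁ + M₂)
      (gate (lconv M₁ M₂ (fun h => TP[lo₁, hi₁, γ₁, h]) (fun h => TR[s₁, s₂, s₃, p₁, p₂, p₃, h])) q)

/-- **CELL TT (LIGHT TRIPLE ⊗ LIGHT TRIPLE) of `SingleGateConvClosed`.**  Both factors admissible non-heavy-decomposable three-atom laws with
positive masses (cell L3's datum on each side: `s₁ < s₂ < s₃ ≤ M₁`, masses `pᵢ`, mean `T₁`; `r₁ < r₂ < r₃ ≤ M₂`, masses `wᵢ`, mean `T₂`);
conclusion: `gate_q(μ₁ ∗ μ₂)` DEC at every layer `j′ < M₁ + M₂` (floor `y`).  A literal sub-statement of `SingleGateConvClosed` (and of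
`SGCLightTriple`).
builds on p205010 (kernel theorem, internal audit signed; external expert review pending). [this work] [status: open] -/
@[conjecture] def SGCLightTripleTriple : Prop :=
  ∀ (y q p₁ p₂ p₃ T₁ w₁ w₂ w₃ T₂ : ℝ) (M₁ M₂ s₁ s₂ s₃ r₁ r₂ r₃ : ℕ),
    0 < y → y < 1 → 0 < q → q ≤ 1 →
    s₁ < s₂ → s₂ < s₃ → s₃ ≤ M₁ → 0 < p₁ → 0 < p₂ → 0 < p₃ → p₁ + p₂ + p₃ = 1 →
    p₁ * (s₁ : ℝ) + p₂ * (s₂ : ℝ) + p₃ * (s₃ : ℝ) = T₁ →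
    y * (M₁ : ℝ) ≤ q * T₁ →
    ((s₂ : ℝ) ≤ T₁ ∧ q * (T₁ - s₂) < y * ((s₃ : ℝ) - s₂) ∨ T₁ < (s₂ : ℝ) ∧ q * (T₁ - s₁) < y * ((s₃ : ℝ) - s₁)) →
    (∀ j', j' < M₁ → DECAt y j' M₁ (gate (fun h => TR[s₁, s₂, s₃, p₁, p₂, p₃, h]) q)) →
    r₁ < r₂ → r₂ < r₃ → r₃ ≤ M₂ → 0 < w₁ → 0 < w₂ → 0 < w₃ → w₁ + w₂ + w₃ = 1 →
    w₁ * (r₁ : ℝ) + w₂ * (r₂ : ℝ) + w₃ * (r₃ : ℝ) = T₂ →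
    y * (M₂ : ℝ) ≤ q * T₂ →
    ((r₂ : ℝ) ≤ T₂ ∧ q * (T₂ - r₂) < y * ((r₃ : ℝ) - r₂) ∨ T₂ < (r₂ : ℝ) ∧ q * (T₂ - r₁) < y * ((r₃ : ℝ) - r₁)) →
    (∀ j', j' < M₂ → DECAt y j' M₂ (gate (fun h => TR[r₁, r₂, r₃, w₁, w₂, w₃, h]) q)) →
    ∀ j', j' < M₁ + M₂ → DECAt y j' (M₁ + M₂)
      (gate (lconv M₁ M₂ (fun h => TR[s₁, s₂, s₃, p₁, p₂, p₃, h]) (fun h => TR[r₁, r₂, r₃, w₁, w₂, w₃, h])) q)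

/-! ### Law bookkeeping -/

/-- a two-point law `{lo, hi; γ}` with `lo ≤ hi ≤ M`, `0 ≤ γ ≤ 1` is a probability law on `{0..M}` of mean `lo + (hi − lo)γ`. [folklore] -/
theorem tp_laws (M lo hi : ℕ) (γ : ℝ) (hγ0 : 0 ≤ γ) (hγ1 : γ ≤ 1) (hlohi : lo ≤ hi) (hhi : hi ≤ M) :
    (∀ h, 0 ≤ TP[lo, hi, γ, h]) ∧ (∀ h, M < h → TP[lo, hi, γ, h] = 0) ∧
      (∑ h ∈ Finset.range (M + 1), TP[lo, hi, γ, h] = 1) ∧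
      (∑ h ∈ Finset.range (M + 1), (h : ℝ) * TP[lo, hi, γ, h] = (lo : ℝ) + ((hi : ℝ) - lo) * γ) := by
  obtain ⟨h0, hM, h1, h2⟩ := twoPointMix_laws (ι := Unit) M ((lo : ℝ) + ((hi : ℝ) - lo) * γ) (fun _ => (1 : ℝ)) (fun _ => γ)
    (fun _ => lo) (fun _ => hi) (fun _ => zero_le_one) (by simp) (fun _ => ⟨hγ0, hγ1⟩) (fun _ => hlohi) (fun _ => hhi)
    (fun _ _ => rfl)
  simp only [Finset.univ_unique, Finset.sum_singleton, one_mul] at h0 hM h1 h2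
  exact ⟨h0, hM, h1, h2⟩

/-- a three-atom law `p₁δ_{s₁} + p₂δ_{s₂} + p₃δ_{s₃}` with `sᵢ ≤ M`, `pᵢ ≥ 0`, `Σ pᵢ = 1`, `Σ pᵢsᵢ = T` is a probability law on `{0..M}` of
mean `T`. [folklore] -/
theorem triple_laws' (p₁ p₂ p₃ T : ℝ) (M s₁ s₂ s₃ : ℕ) (h₁ : s₁ ≤ M) (h₂ : s₂ ≤ M) (h₃ : s₃ ≤ M) (hp₁ : 0 ≤ p₁) (hp₂ : 0 ≤ p₂)
    (hp₃ : 0 ≤ p₃) (hp : p₁ + p₂ + p₃ = 1) (hT : p₁ * (s₁ : ℝ) + p₂ * (s₂ : ℝ) + p₃ * (s₃ : ℝ) = T) :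
    (∀ h, 0 ≤ TR[s₁, s₂, s₃, p₁, p₂, p₃, h]) ∧ (∀ h, M < h → TR[s₁, s₂, s₃, p₁, p₂, p₃, h] = 0) ∧
      (∑ h ∈ Finset.range (M + 1), TR[s₁, s₂, s₃, p₁, p₂, p₃, h] = 1) ∧
      (∑ h ∈ Finset.range (M + 1), (h : ℝ) * TR[s₁, s₂, s₃, p₁, p₂, p₃, h] = T) := by
  obtain ⟨m1, m2⟩ := triple_laws p₁ p₂ p₃ T M s₁ s₂ s₃ h₁ h₂ h₃ hp hT
  refine ⟨fun h => ?_, fun h hh => ?_, m1, m2⟩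
  · have i₁ : 0 ≤ (if h = s₁ then (1 : ℝ) else 0) := by split_ifs <;> norm_num
    have i₂ : 0 ≤ (if h = s₂ then (1 : ℝ) else 0) := by split_ifs <;> norm_num
    have i₃ : 0 ≤ (if h = s₃ then (1 : ℝ) else 0) := by split_ifs <;> norm_num
    positivity
  · rw [if_neg (by omega), if_neg (by omega), if_neg (by omega)]; ring

/-- mass and mean of a finite mixture `μ = Σ_k v_k·ω_k` (`v ≥ 0`, `Σ v = 1`) of probability laws on `{0..M}` with a common mean `T`.
[folklore] -/
theorem mixture_laws {κ : Type} [Fintype κ] (M : ℕ) (T : ℝ) (μ : ℕ → ℝ) (v : κ → ℝ) (ω : κ → ℕ → ℝ)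
    (hv0 : ∀ k, 0 ≤ v k) (hv1 : ∑ k, v k = 1) (hμ : ∀ h, μ h = ∑ k, v k * ω k h)
    (hω1 : ∀ k, 0 < v k → ∑ h ∈ Finset.range (M + 1), ω k h = 1)
    (hωmean : ∀ k, 0 < v k → ∑ h ∈ Finset.range (M + 1), (h : ℝ) * ω k h = T) :
    (∑ h ∈ Finset.range (M + 1), μ h = 1) ∧ (∑ h ∈ Finset.range (M + 1), (h : ℝ) * μ h = T) := by
  constructor
  · simp_rw [hμ]
    rw [Finset.sum_comm]
    have e : ∀ k, ∑ h ∈ Finset.range (M + 1), v k * ω k h = v k := by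
      intro k
      rw [← Finset.mul_sum]
      rcases (hv0 k).eq_or_lt with hz | hpos
      · rw [← hz]; ring
      · rw [hω1 k hpos, mul_one]
    simp_rw [e]; exact hv1
  · simp_rw [hμ]
    have e0 : ∀ h : ℕ, (h : ℝ) * ∑ k, v k * ω k h = ∑ k, v k * ((h : ℝ) * ω k h) := by
      intro h; rw [Finset.mul_sum]; refine Finset.sum_congr rfl fun k _ => ?_; ring
    simp_rw [e0]
    rw [Finset.sum_comm]
    have e : ∀ k, ∑ h ∈ Finset.range (M + 1), v k * ((h : ℝ) * ω k h) = v k * T := by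
      intro k
      rw [← Finset.mul_sum]
      rcases (hv0 k).eq_or_lt with hz | hpos
      · rw [← hz]; ring
      · rw [hωmean k hpos]
    simp_rw [e]
    rw [← Finset.sum_mul, hv1, one_mul]

/-! ### The blob / zero-pair first factor is CW (typer g30's "first sub-cell of L2" is not a new cell) -/

/-- **FIRST FACTOR A ZERO PAIR `{0, a; g}`** (`1 ≤ a ≤ M₁`, `g ≤ 1`; a gated blob — `g ≥ y/q > 0` is forced): in SGC's binder its top-affordability
`y·M₁ ≤ q·(a g)` forces the pair to be HEAVY (`y ≤ q·g`), so for every admissible second factor `μ₂` (SGC's hypotheses) the conclusion of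
`SingleGateConvClosed` follows from CW alone — `singleGateConvClosed_heavyMix_of_windowMix` with the roles of the factors exchanged
(`lconv_comm`).  In particular the sub-cell "μ₁ a gated blob" of `SGCLightPair` / `SGCLightTriple` is already conditional on CW only. [this work] -/
theorem singleGateConvClosed_zeroPair_left_of_windowMix (hCW : WindowMixDEC) (y q g : ℝ) (M₁ M₂ a : ℕ) (μ₂ : ℕ → ℝ)
    (hy0 : 0 < y) (hy1 : y < 1) (hq0 : 0 < q) (hq1 : q ≤ 1)
    (ha1 : 1 ≤ a) (haM : a ≤ M₁) (hg1 : g ≤ 1)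
    (hta₁ : y * (M₁ : ℝ) ≤ q * ((0 : ℕ) + ((a : ℝ) - (0 : ℕ)) * g))
    (hν0 : ∀ h, 0 ≤ μ₂ h) (hνM : ∀ h, M₂ < h → μ₂ h = 0) (hν1 : ∑ h ∈ Finset.range (M₂ + 1), μ₂ h = 1)
    (hta₂ : y * (M₂ : ℝ) ≤ q * ∑ h ∈ Finset.range (M₂ + 1), (h : ℝ) * μ₂ h)
    (hD₂ : ∀ j', j' < M₂ → DECAt y j' M₂ (gate μ₂ q)) :
    ∀ j', j' < M₁ + M₂ → DECAt y j' (M₁ + M₂) (gate (lconv M₁ M₂ (fun h => TP[0, a, g, h]) μ₂) q) := by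
  -- the zero pair is heavy: `y ≤ y·M₁/a ≤ q·g`
  have hheavy : y ≤ q * g := by
    have ha : (1 : ℝ) ≤ a := by exact_mod_cast ha1
    have haM' : (a : ℝ) ≤ M₁ := by exact_mod_cast haM
    have e : q * ((0 : ℕ) + ((a : ℝ) - (0 : ℕ)) * g) = (a : ℝ) * (q * g) := by push_cast; ring
    rw [e] at hta₁
    have h1 : y * (a : ℝ) ≤ y * (M₁ : ℝ) := mul_le_mul_of_nonneg_left haM' hy0.le
    nlinarith
  intro j' hj'
  have h := singleGateConvClosed_heavyMix_of_windowMix hCW y q (((0 : ℕ) : ℝ) + ((a : ℝ) - (0 : ℕ)) * g) M₂ M₁ μ₂ (ι := Unit)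
    (fun _ => (1 : ℝ)) (fun _ => g) (fun _ => 0) (fun _ => a) hy0 hy1 hq0 hq1 hν0 hνM hν1 hta₂ hD₂ (fun _ => zero_le_one) (by simp)
    (fun _ => hg1) (fun _ => hheavy) (fun _ => Nat.zero_le a) (fun _ => haM) (fun _ => rfl) j' (by omega)
  have e : (fun h => ∑ _i : Unit, (1 : ℝ) * TP[0, a, g, h]) = fun h => TP[0, a, g, h] := by
    funext h; simp only [Finset.univ_unique, Finset.sum_singleton, one_mul]
  rw [e] at h
  rw [lconv_comm, Nat.add_comm]; exact h

/-! ### The reductions: L2 and L3 for an AD3⁺-decomposed first factor, from CW + the explicit cells -/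

/-- **CELL L2 FOR AN AD3⁺-DECOMPOSED FIRST FACTOR ⟸ CW + PP + PT.**  Floor `0 < y < 1`, gate `0 < q ≤ 1`; the second factor is ONE
admissible LIGHT pair `{lo, hi; γ}` on `{0..M₂}` (cell L2's datum: `lo < hi ≤ M₂`, `0 ≤ γ ≤ 1`, `q·γ < y`, `y·M₂ ≤ q(lo + (hi−lo)γ)`, gated
version DEC at every layer `j′ < M₂`); the first factor is `μ₁ = Σ_k v_k·ω_k` (`v ≥ 0`, `Σ v = 1`) whose charged components are laws on
`{0..M₁}` of a common mean `T₁` with `y·M₁ ≤ q·T₁`, each a heavy pair (→ CW, the light pair being an admissible first factor), an admissible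
light pair (→ PP) or an admissible non-HD triple (→ PT, after `lconv_comm`).  Then `gate_q(μ₁ ∗ {lo, hi; γ})` is DEC at every layer
`j′ < M₁ + M₂` — L2's conclusion for this pair of factors. [this work] -/
theorem sgcLightPair_of_cells_left (hCW : WindowMixDEC) (hPP : SGCLightPairPair) (hPT : SGCLightPairTriple)
    (y q γ T₁ : ℝ) (M₁ M₂ lo hi : ℕ) (μ₁ : ℕ → ℝ) {κ : Type} [Fintype κ] (v : κ → ℝ) (ω : κ → ℕ → ℝ)
    (hy0 : 0 < y) (hy1 : y < 1) (hq0 : 0 < q) (hq1 : q ≤ 1)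
    (hlohi : lo < hi) (hhi : hi ≤ M₂) (hγ0 : 0 ≤ γ) (hγ1 : γ ≤ 1) (hlight : q * γ < y)
    (hta₂ : y * (M₂ : ℝ) ≤ q * ((lo : ℝ) + ((hi : ℝ) - lo) * γ))
    (hD₂ : ∀ j', j' < M₂ → DECAt y j' M₂ (gate (fun h => TP[lo, hi, γ, h]) q))
    (hta₁ : y * (M₁ : ℝ) ≤ q * T₁)
    (hv0 : ∀ k, 0 ≤ v k) (hv1 : ∑ k, v k = 1) (hμ₁ : ∀ h, μ₁ h = ∑ k, v k * ω k h)
    (hcomp : ∀ k, 0 < v k →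
      (∃ (lo' hi' : ℕ) (γ' : ℝ), lo' ≤ hi' ∧ hi' ≤ M₁ ∧ 0 ≤ γ' ∧ γ' ≤ 1 ∧ y ≤ q * γ' ∧
          (lo' : ℝ) + ((hi' : ℝ) - lo') * γ' = T₁ ∧ ω k = fun h => TP[lo', hi', γ', h]) ∨
      (∃ (lo' hi' : ℕ) (γ' : ℝ), lo' < hi' ∧ hi' ≤ M₁ ∧ 0 ≤ γ' ∧ γ' ≤ 1 ∧ q * γ' < y ∧
          (lo' : ℝ) + ((hi' : ℝ) - lo') * γ' = T₁ ∧ (∀ j', j' < M₁ → DECAt y j' M₁ (gate (fun h => TP[lo', hi', γ', h]) q)) ∧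
          ω k = fun h => TP[lo', hi', γ', h]) ∨
      (∃ (s₁ s₂ s₃ : ℕ) (p₁ p₂ p₃ : ℝ), s₁ < s₂ ∧ s₂ < s₃ ∧ s₃ ≤ M₁ ∧ 0 < p₁ ∧ 0 < p₂ ∧ 0 < p₃ ∧ p₁ + p₂ + p₃ = 1 ∧
          p₁ * (s₁ : ℝ) + p₂ * (s₂ : ℝ) + p₃ * (s₃ : ℝ) = T₁ ∧
          ((s₂ : ℝ) ≤ T₁ ∧ q * (T₁ - s₂) < y * ((s₃ : ℝ) - s₂) ∨ T₁ < (s₂ : ℝ) ∧ q * (T₁ - s₁) < y * ((s₃ : ℝ) - s₁)) ∧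
          (∀ j', j' < M₁ → DECAt y j' M₁ (gate (fun h => TR[s₁, s₂, s₃, p₁, p₂, p₃, h]) q)) ∧
          ω k = fun h => TR[s₁, s₂, s₃, p₁, p₂, p₃, h])) :
    ∀ j', j' < M₁ + M₂ → DECAt y j' (M₁ + M₂) (gate (lconv M₁ M₂ μ₁ (fun h => TP[lo, hi, γ, h])) q) := by
  -- the light pair as a (first) factor: its laws
  obtain ⟨hπ0, hπM, hπ1, hπmean⟩ := tp_laws M₂ lo hi γ hγ0 hγ1 hlohi.le hhi
  have hta₂' : y * (M₂ : ℝ) ≤ q * ∑ h ∈ Finset.range (M₂ + 1), (h : ℝ) * TP[lo, hi, γ, h] := by rw [hπmean]; exact hta₂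
  -- laws of the components of `μ₁`
  have hlaw : ∀ k, 0 < v k →
      (∑ h ∈ Finset.range (M₁ + 1), ω k h = 1) ∧ (∑ h ∈ Finset.range (M₁ + 1), (h : ℝ) * ω k h = T₁) := by
    intro k hk
    rcases hcomp k hk with ⟨lo', hi', γ', hlohi', hhi', hγ0', hγ1', -, hmean, hω⟩ |
      ⟨lo', hi', γ', hlohi', hhi', hγ0', hγ1', -, hmean, -, hω⟩ | ⟨s₁, s₂, s₃, p₁, p₂, p₃, h12, h23, h3, -, -, -, hp, hT, -, -, hω⟩
    · obtain ⟨-, -, h1, h2⟩ := tp_laws M₁ lo' hi' γ' hγ0' hγ1' hlohi' hhi'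
      rw [hω]; exact ⟨h1, hmean ▸ h2⟩
    · obtain ⟨-, -, h1, h2⟩ := tp_laws M₁ lo' hi' γ' hγ0' hγ1' hlohi'.le hhi'
      rw [hω]; exact ⟨h1, hmean ▸ h2⟩
    · rw [hω]; exact triple_laws p₁ p₂ p₃ T₁ M₁ s₁ s₂ s₃ (by omega) (by omega) h3 hp hT
  -- work in the swapped frame: first factor the light pair, second factor `μ₁` decomposed
  have hswap : ∀ j', j' < M₂ + M₁ → DECAt y j' (M₂ + M₁) (gate (lconv M₂ M₁ (fun h => TP[lo, hi, γ, h]) μ₁) q) := by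
    refine decAt_gate_lconv_of_pieces_right y q T₁ M₂ M₁ (fun h => TP[lo, hi, γ, h]) μ₁ v ω hπ1 hv0 hv1 hμ₁
      (fun k hk => (hlaw k hk).1) (fun k hk => (hlaw k hk).2) ?_
    intro k hk
    rcases hcomp k hk with ⟨lo', hi', γ', hlohi', hhi', hγ0', hγ1', hheavy, hmean, hω⟩ |
      ⟨lo', hi', γ', hlohi', hhi', hγ0', hγ1', hlight', hmean, hD', hω⟩ |
      ⟨s₁, s₂, s₃, p₁, p₂, p₃, h12, h23, h3, hp₁, hp₂, hp₃, hp, hT, hnotHD, hD', hω⟩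
    · -- heavy component of `μ₁`: CW with the light pair as the (admissible) first factor
      have h := singleGateConvClosed_heavyMix_of_windowMix hCW y q T₁ M₂ M₁ (fun h => TP[lo, hi, γ, h]) (ι := Unit)
        (fun _ => (1 : ℝ)) (fun _ => γ') (fun _ => lo') (fun _ => hi') hy0 hy1 hq0 hq1 hπ0 hπM hπ1 hta₂' hD₂ (fun _ => zero_le_one)
        (by simp) (fun _ => hγ1') (fun _ => hheavy) (fun _ => hlohi') (fun _ => hhi') (fun _ => hmean)
      have e : (fun h => ∑ _i : Unit, (1 : ℝ) * TP[lo', hi', γ', h]) = ω k := by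
        rw [hω]; funext h; simp only [Finset.univ_unique, Finset.sum_singleton, one_mul]
      rw [← e]; exact h
    · -- light pair component: cell PP
      rw [hω]
      exact hPP y q γ γ' M₂ M₁ lo hi lo' hi' hy0 hy1 hq0 hq1 hlohi hhi hγ0 hγ1 hlight hta₂ hD₂ hlohi' hhi' hγ0' hγ1' hlight'
        (hmean ▸ hta₁) hD'
    · -- light triple component: cell PT
      rw [hω]
      exact hPT y q γ p₁ p₂ p₃ T₁ M₂ M₁ lo hi s₁ s₂ s₃ hy0 hy1 hq0 hq1 hlohi hhi hγ0 hγ1 hlight hta₂ hD₂ h12 h23 h3 hp₁ hp₂ hp₃ hp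
        hT hta₁ hnotHD hD'
  intro j' hj'
  have h := hswap j' (by omega)
  rw [lconv_comm, Nat.add_comm]; exact h

end LawDec

end Quant

end Summit.CriticalPhenomena.PercolationContinuityZ3.Theorems
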